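import Summits.Ventures.YMGap.Thresholds.ZeroCouplingResampling
import Literature.MathematicalPhysics.QuantumLattice.WilsonFeynmanHellmann
import Mathlib.Analysis.Calculus.MeanValue
import HarnessLib

/-!
# The `β = 0` kernel of a plaquette's own four links, EVERY gauge group: second-order Taylor bound for Gibbs
# reweightings, Haar law of the plaquette, decoupling of the neighbours (row type C-SLOPE-0-G, part 1 of 2)

Cell `pub-ymgap`, seat ds-1 (gen 15). HONEST FRAMING: exact LATTICE statements at the strong-coupling END POINT `β = 0`
of the Wilson action `β Σ_p (N − Re tr ρ(U_p))` on `ℤ^d`, for an ARBITRARY compact metrisable gauge group `G`, an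
arbitrary continuous finite-dimensional representation `ρ`, every `d`, both signs of `β`; the tools behind the uniform
first-order expansion of part 2 (`ZeroCouplingSlopeAllGroups`). Generality and exactness, not a threshold; nothing about
weak coupling, the continuum, or the Clay problem. Kernel theorems only, 0 definitions, 0 compute.

## Contents

1. **Second-order Taylor bound for Gibbs reweightings** (`abs_integral_tilted_taylor_two_le`): for a probability measure `P`,
   a bounded energy `|H| ≤ B` and a bounded observable `|F| ≤ C`, `Φ(b) = ∫ F d(P.tilted(−bH))` satisfies
   `|Φ(β) − Φ(0) + β Cov_P(F, H)| ≤ 6 C B² β²` for EVERY real `β` (the Literature's Feynman–Hellmann identities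
   `hasDerivAt_integral_tilted_neg` / `hasDerivAt_covariance_tilted_neg` and the mean value inequality).
2. **The `β = 0` DLR kernel of the four links `Λ = plaquetteEdges p` with boundary condition `η`** (product Haar on `G^Λ`
   glued with `η`, `π⟦Λ, η⟧`): transfer to `dg_∞` (`integral_pi_glueWith_eq_integral_zdHaar`); ★ the plaquette matrix `U_p`
   is Haar distributed for EVERY `η` (`integral_comp_holonomy_pi_glueWith`); ★ DECOUPLING: for every plaquette `q ≠ p` and
   EVERY `η`, `U_p` is Haar distributed independently of `Re tr ρ(U_q)` (`integral_comp_holonomy_mul_plaquetteObs_pi_glueWith`: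
   two distinct plaquettes share at most one link, gen 9's `exists_mem_plaquetteEdges_not_mem`; resample a private link of `p`,
   gen 11's `integral_comp_plaquette_mul_eq`); ★ the kernel covariance of `φ(U_p)` with the boundary Wilson action `S_Λ`
   (`|S_Λ| ≤ (N + M) #plaquettesTouching Λ`, `abs_wilsonBoundaryAction_le_card`) is the BOUNDARY-INDEPENDENT Haar number
   `−Cov_Haar(φ, Re tr ρ)` (`cov_holonomy_wilsonBoundaryAction_pi_glueWith`).

References (mechanism): B. Simon, *The Statistical Mechanics of Lattice Gases* I (1993) §II.1 (Feynman–Hellmann);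
R. Balian, J.-M. Drouffe, C. Itzykson, PRD 11 (1975) 2104 §III; K. Osterwalder, E. Seiler, Ann. Phys. 110 (1978) 440 §3.
-/

noncomputable section

open MeasureTheory ProbabilityTheory Set Filter Topology Finset
open scoped NNReal
open Literature.Probability.LatticeModels (glueWith glueWith_apply_mem glueWith_apply_not_mem measurable_glueWith)
open Literature.MathematicalPhysics.QuantumLattice (LGConfig ZdEdge ZdPlaquette plaquetteObs plaquetteEdges
  plaquettesTouching plaquetteHolonomyZd wilsonBoundaryAction IsCylinder mem_plaquettesTouching_iff isCylinder_plaquetteObs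
  continuous_plaquetteObs)
open Literature.MathematicalPhysics.QuantumFieldTheory hiding ZdEdge
open Literature.MathematicalPhysics.QuantumFieldTheory.PlaquetteLowerBound (reTr integral_comp_plaquette_eq continuous_reTr)

namespace Summit.Ventures.YMGap.ZeroCouplingSlope

/-! ## 1. Second-order Taylor bound for Gibbs reweightings of a probability measure by a bounded energy -/

section Tilted

variable {Ω : Type*} {mΩ : MeasurableSpace Ω} {P : Measure Ω} [IsProbabilityMeasure P] {F H : Ω → ℝ} {B C : ℝ}

/-- Expectations of a pointwise bounded function under a reweighting `P.tilted(−bH)` of a probability measure by a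
bounded energy are bounded by the same constant. [folklore] -/
theorem abs_integral_tilted_le (hH : Measurable H) (hB : ∀ ω, |H ω| ≤ B) {g : Ω → ℝ} {K : ℝ} (hK : ∀ ω, |g ω| ≤ K)
    (b : ℝ) : |∫ ω, g ω ∂(P.tilted fun ω => -b * H ω)| ≤ K := by
  have hint : Integrable (fun ω => Real.exp (-b * H ω)) P := by
    refine Literature.MathematicalPhysics.QuantumLattice.integrable_of_bound
      ((hH.const_mul _).exp).aestronglyMeasurable (C := Real.exp (|b| * B)) fun ω => ?_
    rw [abs_of_pos (Real.exp_pos _), Real.exp_le_exp]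
    calc -b * H ω ≤ |(-b) * H ω| := le_abs_self _
      _ = |b| * |H ω| := by rw [abs_mul, abs_neg]
      _ ≤ |b| * B := mul_le_mul_of_nonneg_left (hB ω) (abs_nonneg _)
  haveI : IsProbabilityMeasure (P.tilted fun ω => -b * H ω) := isProbabilityMeasure_tilted hint
  have h := norm_integral_le_of_norm_le_const (μ := P.tilted fun ω => -b * H ω) (f := g) (C := K)
    (ae_of_all _ fun ω => by simpa [Real.norm_eq_abs] using hK ω)
  rw [probReal_univ, mul_one] at h
  simpa only [Real.norm_eq_abs] using h

/-- ★ **Second-order Taylor bound for Gibbs reweightings.** For a probability measure `P`, a measurable energy with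
`|H| ≤ B` and a measurable observable with `|F| ≤ C`, the reweighted expectation `Φ(b) = ∫ F d(P.tilted(−bH))`
satisfies, for EVERY real `β`,
`|Φ(β) − Φ(0) + β (∫ F H dP − ∫ F dP ∫ H dP)| ≤ 6 C B² β²`.
Feynman–Hellmann twice (`hasDerivAt_integral_tilted_neg`: `Φ' = −Cov_b(F,H)`; `hasDerivAt_covariance_tilted_neg`:
`Cov_b' = −κ₃` with `|κ₃| ≤ 6 C B²`) and the mean value inequality on the segment `[0, β]`. [folklore] -/
theorem abs_integral_tilted_taylor_two_le (hF : Measurable F) (hC : ∀ ω, |F ω| ≤ C) (hH : Measurable H)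
    (hB : ∀ ω, |H ω| ≤ B) (β : ℝ) :
    |(∫ ω, F ω ∂(P.tilted fun ω => -β * H ω)) - (∫ ω, F ω ∂P) +
        β * ((∫ ω, F ω * H ω ∂P) - (∫ ω, F ω ∂P) * ∫ ω, H ω ∂P)| ≤ 6 * C * B ^ 2 * β ^ 2 := by
  have hint : ∀ b : ℝ, -b ∈ interior (integrableExpSet H P) := fun b => by
    rw [Literature.MathematicalPhysics.QuantumLattice.integrableExpSet_eq_univ_of_abs_le hH.aemeasurable
      (ae_of_all _ hB), interior_univ]
    exact mem_univ _
  have hFm : AEStronglyMeasurable F P := hF.aestronglyMeasurable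
  have hHm : AEStronglyMeasurable H P := hH.aestronglyMeasurable
  have hCn : ∀ᵐ ω ∂P, ‖F ω‖ ≤ C := ae_of_all _ fun ω => by simpa [Real.norm_eq_abs] using hC ω
  have hBn : ∀ᵐ ω ∂P, ‖H ω‖ ≤ B := ae_of_all _ fun ω => by simpa [Real.norm_eq_abs] using hB ω
  set μ : ℝ → Measure Ω := fun b => P.tilted fun ω => -b * H ω with hμ
  set Φ : ℝ → ℝ := fun b => ∫ ω, F ω ∂(μ b) with hΦ
  set M : ℝ → ℝ := fun b => (∫ ω, F ω * H ω ∂(μ b)) - (∫ ω, F ω ∂(μ b)) * ∫ ω, H ω ∂(μ b) with hM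
  set κ : ℝ → ℝ := fun b => -((∫ ω, F ω * H ω * H ω ∂(μ b)) -
      (∫ ω, F ω * H ω ∂(μ b)) * (∫ ω, H ω ∂(μ b)) -
      (∫ ω, H ω ∂(μ b)) * (∫ ω, F ω * H ω ∂(μ b)) -
      (∫ ω, F ω ∂(μ b)) * (∫ ω, H ω * H ω ∂(μ b)) +
      2 * ((∫ ω, F ω ∂(μ b)) * (∫ ω, H ω ∂(μ b)) * ∫ ω, H ω ∂(μ b))) with hκ
  have hΦ' : ∀ b, HasDerivAt Φ (-M b) b := fun b => by
    have h := Literature.MathematicalPhysics.QuantumLattice.hasDerivAt_integral_tilted_neg (μ := P) (F := F)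
      (H := H) (C := C) (hint b) hFm hCn
    simpa [hΦ, hM, hμ] using h
  have hM' : ∀ b, HasDerivAt M (κ b) b := fun b => by
    have h := Literature.MathematicalPhysics.QuantumLattice.hasDerivAt_covariance_tilted_neg (μ := P) (F := F)
      (G := H) (H := H) (C := C) (D := B) (hint b) hFm hCn hHm hBn
    simpa [hM, hκ, hμ] using h
  obtain ⟨ω₀⟩ := nonempty_of_isProbabilityMeasure P
  have hB0 : 0 ≤ B := (abs_nonneg _).trans (hB ω₀)
  have hC0 : 0 ≤ C := (abs_nonneg _).trans (hC ω₀)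
  have hFH : ∀ ω, |F ω * H ω| ≤ C * B := fun ω => (abs_mul _ _).trans_le (mul_le_mul (hC ω) (hB ω) (abs_nonneg _) hC0)
  have hFHH : ∀ ω, |F ω * H ω * H ω| ≤ C * B * B := fun ω =>
    (abs_mul _ _).trans_le (mul_le_mul (hFH ω) (hB ω) (abs_nonneg _) (mul_nonneg hC0 hB0))
  have hHH : ∀ ω, |H ω * H ω| ≤ B * B := fun ω => (abs_mul _ _).trans_le (mul_le_mul (hB ω) (hB ω) (abs_nonneg _) hB0)
  have hκb : ∀ b, |κ b| ≤ 6 * C * B ^ 2 := fun b => by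
    have e1 := abs_integral_tilted_le (P := P) hH hB hFHH b
    have e2 := abs_integral_tilted_le (P := P) hH hB hFH b
    have e3 := abs_integral_tilted_le (P := P) hH hB hB b
    have e4 := abs_integral_tilted_le (P := P) hH hB hC b
    have e5 := abs_integral_tilted_le (P := P) hH hB hHH b
    simp only [hκ]
    rw [abs_neg]
    set x1 := ∫ ω, F ω * H ω * H ω ∂(μ b)
    set x2 := ∫ ω, F ω * H ω ∂(μ b)
    set x3 := ∫ ω, H ω ∂(μ b)
    set x4 := ∫ ω, F ω ∂(μ b)
    set x5 := ∫ ω, H ω * H ω ∂(μ b)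
    have t2 : |x2 * x3| ≤ C * B * B := (abs_mul _ _).trans_le (mul_le_mul e2 e3 (abs_nonneg _) (mul_nonneg hC0 hB0))
    have t3 : |x3 * x2| ≤ B * (C * B) := (abs_mul _ _).trans_le (mul_le_mul e3 e2 (abs_nonneg _) hB0)
    have t4 : |x4 * x5| ≤ C * (B * B) := (abs_mul _ _).trans_le (mul_le_mul e4 e5 (abs_nonneg _) hC0)
    have t45 : |x4 * x3 * x3| ≤ C * B * B := by
      rw [abs_mul, abs_mul]
      exact mul_le_mul (mul_le_mul e4 e3 (abs_nonneg _) hC0) e3 (abs_nonneg _) (mul_nonneg hC0 hB0)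
    have t5 : |2 * (x4 * x3 * x3)| ≤ 2 * (C * B * B) := by
      rw [abs_mul, abs_of_pos (two_pos : (0:ℝ) < 2)]
      exact mul_le_mul_of_nonneg_left t45 (by norm_num)
    calc |x1 - x2 * x3 - x3 * x2 - x4 * x5 + 2 * (x4 * x3 * x3)|
        ≤ |x1| + |x2 * x3| + |x3 * x2| + |x4 * x5| + |2 * (x4 * x3 * x3)| := by
          have := abs_add_le (x1 - x2 * x3 - x3 * x2 - x4 * x5) (2 * (x4 * x3 * x3))
          have := abs_sub (x1 - x2 * x3 - x3 * x2) (x4 * x5)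
          have := abs_sub (x1 - x2 * x3) (x3 * x2)
          have := abs_sub x1 (x2 * x3)
          linarith
      _ ≤ C * B * B + C * B * B + B * (C * B) + C * (B * B) + 2 * (C * B * B) := by
          gcongr
      _ = 6 * C * B ^ 2 := by ring
  have hMlip : ∀ s, |M s - M 0| ≤ 6 * C * B ^ 2 * |s| := fun s => by
    have h := Convex.norm_image_sub_le_of_norm_hasDerivWithin_le (f := M) (f' := κ) (s := univ)
      (fun x _ => (hM' x).hasDerivWithinAt) (fun x _ => by simpa [Real.norm_eq_abs] using hκb x)
      convex_univ (mem_univ 0) (mem_univ s)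
    simpa [Real.norm_eq_abs] using h
  -- `g(b) = Φ b + b M 0` has derivative `M 0 − M b`, of size `≤ 6 C B² |β|` on the segment `[0, β]`
  have hg : ∀ b, HasDerivAt (fun b => Φ b + b * M 0) (-M b + M 0) b := fun b => by
    have h := (hΦ' b).add ((hasDerivAt_id b).mul_const (M 0))
    simp only [id, one_mul] at h
    exact h
  have hseg := Convex.norm_image_sub_le_of_norm_hasDerivWithin_le (f := fun b => Φ b + b * M 0)
    (f' := fun b => -M b + M 0) (s := uIcc 0 β) (C := 6 * C * B ^ 2 * |β|)
    (fun x _ => (hg x).hasDerivWithinAt) (fun x hx => by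
      rw [Real.norm_eq_abs, show -M x + M 0 = -(M x - M 0) by ring, abs_neg]
      refine (hMlip x).trans (mul_le_mul_of_nonneg_left ?_ (by positivity))
      rcases le_total 0 β with hβ | hβ
      · rw [uIcc_of_le hβ] at hx; rw [abs_of_nonneg hx.1, abs_of_nonneg hβ]; exact hx.2
      · rw [uIcc_of_ge hβ] at hx; rw [abs_of_nonpos hx.2, abs_of_nonpos hβ]; linarith [hx.1])
    (convex_uIcc 0 β) left_mem_uIcc right_mem_uIcc
  have h00 : (fun ω => -(0:ℝ) * H ω) = (0 : Ω → ℝ) := funext fun _ => by simp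
  have hΦ0 : Φ 0 = ∫ ω, F ω ∂P := by simp only [hΦ, hμ]; rw [h00, tilted_zero]
  have hM0 : M 0 = (∫ ω, F ω * H ω ∂P) - (∫ ω, F ω ∂P) * ∫ ω, H ω ∂P := by simp only [hM, hμ]; rw [h00, tilted_zero]
  have hΦβ : Φ β = ∫ ω, F ω ∂(P.tilted fun ω => -β * H ω) := rfl
  have key := hseg
  simp only [Real.norm_eq_abs, zero_mul, add_zero, sub_zero] at key
  rw [hΦβ, hΦ0, hM0] at key
  have e : (∫ ω, F ω ∂(P.tilted fun ω => -β * H ω)) - (∫ ω, F ω ∂P) +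
        β * ((∫ ω, F ω * H ω ∂P) - (∫ ω, F ω ∂P) * ∫ ω, H ω ∂P) =
      (∫ ω, F ω ∂(P.tilted fun ω => -β * H ω)) +
        β * ((∫ ω, F ω * H ω ∂P) - (∫ ω, F ω ∂P) * ∫ ω, H ω ∂P) - ∫ ω, F ω ∂P := by ring
  rw [e]
  calc _ ≤ 6 * C * B ^ 2 * |β| * |β| := key
    _ = 6 * C * B ^ 2 * β ^ 2 := by rw [mul_assoc, ← sq, sq_abs]

end Tilted

/-! ## 2. The `β = 0` kernel of a plaquette's own four links: Haar law of the plaquette, decoupling of the neighbours -/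

section Kernel

variable {d N : ℕ} {G : Type*} [Group G] [TopologicalSpace G] [IsTopologicalGroup G] [CompactSpace G]
  [MeasurableSpace G] [BorelSpace G] [SecondCountableTopology G] (ρ : G →* Matrix (Fin N) (Fin N) ℂ)

/-- The un-tilted kernel measure of the finite edge set `Λ` with boundary condition `η`: product Haar measure on `G^Λ`
glued with `η` off `Λ` (local notation `π⟦Λ, η⟧`). -/
local notation3 (prettyPrint := false) "π⟦" Λ ", " η "⟧" =>
  ((Measure.pi fun _ : ↥(Λ : Finset (ZdEdge d)) => haarProbability G).map (glueWith Λ · (η : LGConfig d G)))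

omit [SecondCountableTopology G] in
/-- `π⟦Λ, η⟧` is a probability measure. [folklore] -/
theorem isProbabilityMeasure_pi_glueWith (Λ : Finset (ZdEdge d)) (η : LGConfig d G) :
    IsProbabilityMeasure π⟦Λ, η⟧ :=
  Measure.isProbabilityMeasure_map (measurable_glueWith Λ η).aemeasurable

omit [SecondCountableTopology G] in
/-- **Transfer to the infinite Haar product**: an integral against the glued finite Haar product is an integral against
`dg_∞ = zdHaar d G`, gluing the `Λ`-part of the sample with `η` (the `Λ`-marginal of `dg_∞` is the finite product,
Mathlib `Measure.infinitePi_map_restrict`). [folklore] -/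
theorem integral_pi_glueWith_eq_integral_zdHaar (Λ : Finset (ZdEdge d)) (η : LGConfig d G) {g : LGConfig d G → ℝ}
    (hg : Measurable g) :
    ∫ U, g U ∂π⟦Λ, η⟧ = ∫ U, g (glueWith Λ (Λ.restrict U) η) ∂(zdHaar d G) := by
  rw [integral_map (measurable_glueWith Λ η).aemeasurable hg.aestronglyMeasurable]
  have hk : Measurable fun ζ : ↥Λ → G => g (glueWith Λ ζ η) := hg.comp (measurable_glueWith Λ η)
  rw [zdHaar, ← Measure.infinitePi_map_restrict (μ := fun _ : ZdEdge d => haarProbability G) (I := Λ),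
    integral_map (Finset.measurable_restrict Λ).aemeasurable hk.aestronglyMeasurable]

omit [Group G] [TopologicalSpace G] [IsTopologicalGroup G] [CompactSpace G] [MeasurableSpace G] [BorelSpace G]
  [SecondCountableTopology G] in
/-- A cylinder observable supported in `Λ` does not see the gluing of its own support. [folklore] -/
theorem apply_glueWith_restrict_of_isCylinder {α : Type*} {Λ : Finset (ZdEdge d)} {F : LGConfig d G → α}
    (hF : IsCylinder F Λ) (U η : LGConfig d G) : F (glueWith Λ (Λ.restrict U) η) = F U :=
  hF fun e he => by
    rw [glueWith_apply_mem _ _ _ (Finset.mem_coe.1 he)]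
    rfl

omit [TopologicalSpace G] [IsTopologicalGroup G] [CompactSpace G] [MeasurableSpace G] [BorelSpace G]
  [SecondCountableTopology G] in
/-- The plaquette holonomy is a cylinder observable supported on the four edges of the plaquette. [folklore] -/
theorem isCylinder_plaquetteHolonomyZd (p : ZdPlaquette d) :
    IsCylinder (fun U : LGConfig d G => plaquetteHolonomyZd U p.1 p.2.1.1 p.2.1.2) (plaquetteEdges p) := by
  intro U V h
  simp only [plaquetteHolonomyZd]
  rw [h (p.1, p.2.1.1) (by simp [plaquetteEdges]), h (p.1 + Pi.single p.2.1.1 1, p.2.1.2) (by simp [plaquetteEdges]),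
    h (p.1 + Pi.single p.2.1.2 1, p.2.1.1) (by simp [plaquetteEdges]), h (p.1, p.2.1.2) (by simp [plaquetteEdges])]

omit [Group G] [IsTopologicalGroup G] [CompactSpace G] [MeasurableSpace G] [BorelSpace G] [SecondCountableTopology G] in
/-- Gluing the `Λ`-part of a configuration with a fixed boundary condition is continuous. [folklore] -/
theorem continuous_glueWith_restrict (Λ : Finset (ZdEdge d)) (η : LGConfig d G) :
    Continuous fun U : LGConfig d G => glueWith Λ (Λ.restrict U) η := by
  refine continuous_pi fun e => ?_
  by_cases he : e ∈ Λ
  · simp only [glueWith_apply_mem _ _ _ he]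
    exact continuous_apply e
  · simp only [glueWith_apply_not_mem _ _ _ he]
    exact continuous_const

/-- A continuous real function on the (compact) configuration space is integrable for `π⟦Λ, η⟧`. [folklore] -/
theorem integrable_pi_glueWith_of_continuous (Λ : Finset (ZdEdge d)) (η : LGConfig d G) {g : LGConfig d G → ℝ}
    (hg : Continuous g) : Integrable g π⟦Λ, η⟧ := by
  haveI : IsProbabilityMeasure π⟦Λ, η⟧ := isProbabilityMeasure_pi_glueWith Λ η
  obtain ⟨C, hC⟩ := Literature.MathematicalPhysics.QuantumLattice.exists_bound_of_continuous hg
  exact Literature.MathematicalPhysics.QuantumLattice.integrable_of_bound hg.aestronglyMeasurable hC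

/-- ★ **Under the `β = 0` kernel of its own four links, the plaquette matrix is Haar distributed — for EVERY boundary
condition**: `∫ φ(U_p) dπ⟦plaquetteEdges p, η⟧ = ∫ φ dHaar` (one-link Haar invariance, the Literature's
`integral_comp_plaquette_eq`, after transfer to `dg_∞`). [folklore] -/
theorem integral_comp_holonomy_pi_glueWith {φ : G → ℝ} (hφ : Continuous φ) (p : ZdPlaquette d) (η : LGConfig d G) :
    ∫ U, φ (plaquetteHolonomyZd U p.1 p.2.1.1 p.2.1.2) ∂π⟦plaquetteEdges p, η⟧ = ∫ g, φ g ∂haarProbability G := by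
  have hm : Measurable fun U : LGConfig d G => φ (plaquetteHolonomyZd U p.1 p.2.1.1 p.2.1.2) :=
    (hφ.comp (AreaLaw.continuous_plaquette p.1 p.2.1.1 p.2.1.2)).measurable
  rw [integral_pi_glueWith_eq_integral_zdHaar (plaquetteEdges p) η hm]
  have hcyl := isCylinder_plaquetteHolonomyZd (G := G) p
  have h : ∀ U : LGConfig d G, plaquetteHolonomyZd (glueWith (plaquetteEdges p) ((plaquetteEdges p).restrict U) η)
      p.1 p.2.1.1 p.2.1.2 = plaquetteHolonomyZd U p.1 p.2.1.1 p.2.1.2 := fun U =>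
    apply_glueWith_restrict_of_isCylinder hcyl U η
  simp_rw [h]
  exact integral_comp_plaquette_eq hφ p.1 (ne_of_lt p.2.2)

/-- ★ **Decoupling of the neighbours at `β = 0`**: for a plaquette `q ≠ p` and EVERY boundary condition `η`, under
`π⟦plaquetteEdges p, η⟧` the plaquette matrix `U_p` is Haar distributed INDEPENDENTLY of the plaquette observable of `q`:
`∫ φ(U_p) · Re tr ρ(U_q) dπ = (∫ φ dHaar) · ∫ Re tr ρ(U_q) dπ`. Two distinct plaquettes share at most one link, so `p` has a
link outside `q` (gen 9's `exists_mem_plaquetteEdges_not_mem`); resample it (gen 11's `integral_comp_plaquette_mul_eq`). [folklore] -/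
theorem integral_comp_holonomy_mul_plaquetteObs_pi_glueWith (hρ : Continuous ρ) {φ : G → ℝ} (hφ : Continuous φ)
    {p q : ZdPlaquette d} (hpq : p ≠ q) (η : LGConfig d G) :
    ∫ U, φ (plaquetteHolonomyZd U p.1 p.2.1.1 p.2.1.2) * plaquetteObs ρ q.1 q.2.1.1 q.2.1.2 U ∂π⟦plaquetteEdges p, η⟧ =
      (∫ g, φ g ∂haarProbability G) * ∫ U, plaquetteObs ρ q.1 q.2.1.1 q.2.1.2 U ∂π⟦plaquetteEdges p, η⟧ := by
  classical
  have hhol : Continuous fun U : LGConfig d G => φ (plaquetteHolonomyZd U p.1 p.2.1.1 p.2.1.2) :=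
    hφ.comp (AreaLaw.continuous_plaquette p.1 p.2.1.1 p.2.1.2)
  have hobs : Continuous (plaquetteObs (G := G) ρ q.1 q.2.1.1 q.2.1.2) := continuous_plaquetteObs ρ hρ _ _ _
  have hm : Measurable fun U : LGConfig d G =>
      φ (plaquetteHolonomyZd U p.1 p.2.1.1 p.2.1.2) * plaquetteObs ρ q.1 q.2.1.1 q.2.1.2 U := (hhol.mul hobs).measurable
  rw [integral_pi_glueWith_eq_integral_zdHaar (plaquetteEdges p) η hm,
    integral_pi_glueWith_eq_integral_zdHaar (plaquetteEdges p) η hobs.measurable]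
  have hcyl := isCylinder_plaquetteHolonomyZd (G := G) p
  have h : ∀ U : LGConfig d G, plaquetteHolonomyZd (glueWith (plaquetteEdges p) ((plaquetteEdges p).restrict U) η)
      p.1 p.2.1.1 p.2.1.2 = plaquetteHolonomyZd U p.1 p.2.1.1 p.2.1.2 := fun U =>
    apply_glueWith_restrict_of_isCylinder hcyl U η
  simp_rw [h]
  -- a link of `p` outside `q`
  obtain ⟨e, hep, heq⟩ := PressureRegularity.exists_mem_plaquetteEdges_not_mem hpq
  -- the neighbour's observable, read through the gluing, ignores that link
  have hΨc : Continuous fun U : LGConfig d G =>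
      plaquetteObs ρ q.1 q.2.1.1 q.2.1.2 (glueWith (plaquetteEdges p) ((plaquetteEdges p).restrict U) η) :=
    hobs.comp (continuous_glueWith_restrict (plaquetteEdges p) η)
  have hΨe : ∀ (U : LGConfig d G) (g : G),
      plaquetteObs ρ q.1 q.2.1.1 q.2.1.2
          (glueWith (plaquetteEdges p) ((plaquetteEdges p).restrict (Function.update U e g)) η) =
        plaquetteObs ρ q.1 q.2.1.1 q.2.1.2 (glueWith (plaquetteEdges p) ((plaquetteEdges p).restrict U) η) := by
    intro U g
    refine isCylinder_plaquetteObs ρ q fun e' he' => ?_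
    have hne : e' ≠ e := by rintro rfl; exact heq (Finset.mem_coe.1 he')
    by_cases he'Λ : e' ∈ plaquetteEdges p
    · rw [glueWith_apply_mem _ _ _ he'Λ, glueWith_apply_mem _ _ _ he'Λ]
      show Function.update U e g e' = U e'
      rw [Function.update_of_ne hne]
    · rw [glueWith_apply_not_mem _ _ _ he'Λ, glueWith_apply_not_mem _ _ _ he'Λ]
  exact ZeroCouplingMoments.integral_comp_plaquette_mul_eq hφ p hep hΨc hΨe

omit [TopologicalSpace G] [IsTopologicalGroup G] [CompactSpace G] [MeasurableSpace G] [BorelSpace G]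
  [SecondCountableTopology G] in
/-- A plaquette touches its own edge set. [folklore] -/
theorem mem_plaquettesTouching_plaquetteEdges (p : ZdPlaquette d) : p ∈ plaquettesTouching (plaquetteEdges p) :=
  mem_plaquettesTouching_iff.2 ⟨(p.1, p.2.1.1), Finset.mem_inter.2 ⟨by simp [plaquetteEdges], by simp [plaquetteEdges]⟩⟩

omit [TopologicalSpace G] [IsTopologicalGroup G] [CompactSpace G] [MeasurableSpace G] [BorelSpace G]
  [SecondCountableTopology G] in
/-- **Boundedness of the boundary Wilson action**: `|S_Λ(U)| ≤ (N + M) · #plaquettesTouching Λ` when `|Re tr ρ| ≤ M`.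
[folklore] -/
theorem abs_wilsonBoundaryAction_le_card {M : ℝ} (hM : ∀ g : G, |(ρ g).trace.re| ≤ M) (Λ : Finset (ZdEdge d))
    (U : LGConfig d G) : |wilsonBoundaryAction ρ Λ U| ≤ ((N : ℝ) + M) * (plaquettesTouching Λ).card := by
  unfold wilsonBoundaryAction
  refine (Finset.abs_sum_le_sum_abs _ _).trans ?_
  refine (Finset.sum_le_card_nsmul _ _ ((N : ℝ) + M) fun q _ => ?_).trans ?_
  · have h1 := hM (plaquetteHolonomyZd U q.1 q.2.1.1 q.2.1.2)
    rw [abs_le] at h1 ⊢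
    have hN : (0 : ℝ) ≤ N := Nat.cast_nonneg N
    simp only [plaquetteObs]
    constructor <;> linarith [h1.1, h1.2]
  · rw [nsmul_eq_mul, mul_comm]

/-- ★ **The `β = 0` kernel covariance of `φ(U_p)` with the boundary Wilson action of the four links of `p` is the
boundary-independent Haar number `−Cov_Haar(φ, Re tr ρ)`**, for EVERY boundary condition `η`: the plaquette `p` itself
contributes `Cov_Haar(φ, N − Re tr ρ)`, every neighbouring plaquette contributes `0` (decoupling). [folklore] -/
theorem cov_holonomy_wilsonBoundaryAction_pi_glueWith (hρ : Continuous ρ) {φ : G → ℝ} (hφ : Continuous φ)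
    (p : ZdPlaquette d) (η : LGConfig d G) :
    (∫ U, φ (plaquetteHolonomyZd U p.1 p.2.1.1 p.2.1.2) * wilsonBoundaryAction ρ (plaquetteEdges p) U
        ∂π⟦plaquetteEdges p, η⟧) -
      (∫ U, φ (plaquetteHolonomyZd U p.1 p.2.1.1 p.2.1.2) ∂π⟦plaquetteEdges p, η⟧) *
        ∫ U, wilsonBoundaryAction ρ (plaquetteEdges p) U ∂π⟦plaquetteEdges p, η⟧ =
      -((∫ g, φ g * reTr ρ g ∂haarProbability G) -
        (∫ g, φ g ∂haarProbability G) * ∫ g, reTr ρ g ∂haarProbability G) := by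
  classical
  haveI : IsProbabilityMeasure π⟦plaquetteEdges p, η⟧ := isProbabilityMeasure_pi_glueWith (plaquetteEdges p) η
  have hhol : Continuous fun U : LGConfig d G => φ (plaquetteHolonomyZd U p.1 p.2.1.1 p.2.1.2) :=
    hφ.comp (AreaLaw.continuous_plaquette p.1 p.2.1.1 p.2.1.2)
  have hobs : ∀ q : ZdPlaquette d, Continuous (plaquetteObs (G := G) ρ q.1 q.2.1.1 q.2.1.2) := fun q =>
    continuous_plaquetteObs ρ hρ _ _ _
  -- expand the boundary action
  have hW : ∀ U : LGConfig d G, wilsonBoundaryAction ρ (plaquetteEdges p) U =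
      ∑ q ∈ plaquettesTouching (plaquetteEdges p), ((N : ℝ) - plaquetteObs ρ q.1 q.2.1.1 q.2.1.2 U) := fun U => rfl
  have h1 : ∫ U, φ (plaquetteHolonomyZd U p.1 p.2.1.1 p.2.1.2) * wilsonBoundaryAction ρ (plaquetteEdges p) U
        ∂π⟦plaquetteEdges p, η⟧ =
      ∑ q ∈ plaquettesTouching (plaquetteEdges p),
        ((N : ℝ) * (∫ g, φ g ∂haarProbability G) - ∫ U, φ (plaquetteHolonomyZd U p.1 p.2.1.1 p.2.1.2) *
          plaquetteObs ρ q.1 q.2.1.1 q.2.1.2 U ∂π⟦plaquetteEdges p, η⟧) := by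
    have hre : ∀ U : LGConfig d G,
        φ (plaquetteHolonomyZd U p.1 p.2.1.1 p.2.1.2) * wilsonBoundaryAction ρ (plaquetteEdges p) U =
          ∑ q ∈ plaquettesTouching (plaquetteEdges p), ((N : ℝ) * φ (plaquetteHolonomyZd U p.1 p.2.1.1 p.2.1.2) -
            φ (plaquetteHolonomyZd U p.1 p.2.1.1 p.2.1.2) * plaquetteObs ρ q.1 q.2.1.1 q.2.1.2 U) := fun U => by
      rw [hW, Finset.mul_sum]
      exact Finset.sum_congr rfl fun q _ => by ring
    simp_rw [hre]
    rw [integral_finsetSum _ fun q _ =>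
      (integrable_pi_glueWith_of_continuous (plaquetteEdges p) η ((continuous_const.mul hhol).sub (hhol.mul (hobs q))) :
        Integrable (fun U : LGConfig d G => (N : ℝ) * φ (plaquetteHolonomyZd U p.1 p.2.1.1 p.2.1.2) -
          φ (plaquetteHolonomyZd U p.1 p.2.1.1 p.2.1.2) * plaquetteObs ρ q.1 q.2.1.1 q.2.1.2 U) π⟦plaquetteEdges p, η⟧)]
    refine Finset.sum_congr rfl fun q _ => ?_
    have hA : Integrable (fun U : LGConfig d G => (N : ℝ) * φ (plaquetteHolonomyZd U p.1 p.2.1.1 p.2.1.2))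
        π⟦plaquetteEdges p, η⟧ :=
      integrable_pi_glueWith_of_continuous (plaquetteEdges p) η (continuous_const.mul hhol)
    have hB : Integrable (fun U : LGConfig d G => φ (plaquetteHolonomyZd U p.1 p.2.1.1 p.2.1.2) *
        plaquetteObs ρ q.1 q.2.1.1 q.2.1.2 U) π⟦plaquetteEdges p, η⟧ :=
      integrable_pi_glueWith_of_continuous (plaquetteEdges p) η (hhol.mul (hobs q))
    rw [integral_sub hA hB, integral_const_mul, integral_comp_holonomy_pi_glueWith hφ p η]
  have h2 : ∫ U, wilsonBoundaryAction ρ (plaquetteEdges p) U ∂π⟦plaquetteEdges p, η⟧ =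
      ∑ q ∈ plaquettesTouching (plaquetteEdges p),
        ((N : ℝ) - ∫ U, plaquetteObs ρ q.1 q.2.1.1 q.2.1.2 U ∂π⟦plaquetteEdges p, η⟧) := by
    simp_rw [hW]
    rw [integral_finsetSum _ fun q _ =>
      (integrable_pi_glueWith_of_continuous (plaquetteEdges p) η (continuous_const.sub (hobs q)) :
        Integrable (fun U : LGConfig d G => (N : ℝ) - plaquetteObs ρ q.1 q.2.1.1 q.2.1.2 U) π⟦plaquetteEdges p, η⟧)]
    refine Finset.sum_congr rfl fun q _ => ?_
    have hB : Integrable (fun U : LGConfig d G => plaquetteObs ρ q.1 q.2.1.1 q.2.1.2 U) π⟦plaquetteEdges p, η⟧ :=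
      integrable_pi_glueWith_of_continuous (plaquetteEdges p) η (hobs q)
    rw [integral_sub (integrable_const _) hB, integral_const, probReal_univ, one_smul]
  rw [h1, h2, integral_comp_holonomy_pi_glueWith hφ p η, Finset.mul_sum, ← Finset.sum_sub_distrib]
  -- only `q = p` survives
  have hp : p ∈ plaquettesTouching (plaquetteEdges p) := mem_plaquettesTouching_plaquetteEdges p
  rw [← Finset.add_sum_erase _ _ hp, Finset.sum_eq_zero fun q hq => ?_]
  · -- the `q = p` term: both moments are Haar moments of the plaquette matrix
    have e1 : ∫ U, φ (plaquetteHolonomyZd U p.1 p.2.1.1 p.2.1.2) * plaquetteObs ρ p.1 p.2.1.1 p.2.1.2 U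
          ∂π⟦plaquetteEdges p, η⟧ = ∫ g, φ g * reTr ρ g ∂haarProbability G :=
      integral_comp_holonomy_pi_glueWith (φ := fun g => φ g * reTr ρ g) (hφ.mul (continuous_reTr ρ hρ)) p η
    have e2 : ∫ U, plaquetteObs ρ p.1 p.2.1.1 p.2.1.2 U ∂π⟦plaquetteEdges p, η⟧ = ∫ g, reTr ρ g ∂haarProbability G :=
      integral_comp_holonomy_pi_glueWith (φ := reTr ρ) (continuous_reTr ρ hρ) p η
    rw [e1, e2, add_zero]
    ring
  · -- `q ≠ p`: decoupling
    have hqp : q ≠ p := Finset.ne_of_mem_erase hq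
    rw [integral_comp_holonomy_mul_plaquetteObs_pi_glueWith ρ hρ hφ hqp.symm η]
    ring

end Kernel

end Summit.Ventures.YMGap.ZeroCouplingSlope
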